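import Literature.NumberTheory.GaloisRepresentations.SerreWeightExistence
import Literature.NumberTheory.GaloisRepresentations.TameInertiaKummerProofs
import HarnessLib

/-!
# Values of the Kummer characters `θ_d` on `I_F`, and Serre's recipe on its last named fact (trunk GalRep; items C15, C16)

D-0014 keeps `Literature/` sorry-free by stating cited results as named facts `def X : Prop`.
The named fact `Literature.exists_eq_kummerCharacter_pow F k` of `TameInertia.lean` (every continuous
character `χ : I_F → kˣ` with `χ ^ d = 1`, `p ∤ d`, is a power of the Kummer character
`θ_d = kummerCharacter F hd hϖ.ne_zero ι`; Serre, Invent. Math. 15 (1972), §1.3 and §1.7,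
Prop. 5) is discharged in `TameInertiaKummerProofs.lean` (`exists_eq_kummerCharacter_pow_holds`).
This sibling file records

* elementary **values of the Kummer characters** (`kummerCharacter_eq_one_of_smul_eq`,
  `coe_kummerCharacter_eq_of_smul_eq`, `kummerCharacter_pow_eq_one`) and
  `Literature.NumberTheory.GaloisRepresentations.exists_isPrimitiveRoot_kummerCharacter` — **`θ_d` takes a primitive `d`-th root of unity
  of `k` as a value** (`p ∤ d`): some `σ₀ ∈ I_F` multiplies `z = ϖ^{1/d}` by a primitive `d`-th
  root of unity `ζ₀ ∈ F̄` (surjectivity of `θ_d`, `UnramifiedKummer.exists_mem_absInertia_smul_eq_mul`,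
  Serre 1972 §1.3 Prop. 2), and `ι(ζ₀ mod 𝔓)` keeps order `d` because roots of unity of order
  prime to `p` stay distinct modulo the proper ideal `ker (ι ∘ mk) ⊇ 𝔓`
  (`TameInertia.eq_one_of_pow_eq_one_of_sub_one_mem`); in particular `θ_d` has exact order `d`;
* `Literature.NumberTheory.GaloisRepresentations.exists_isGalois_ker_subset` — every neighbourhood of `1` in `Γ_F` contains `Gal(F̄/E)` for
  a finite *Galois* `E` (the neighbourhood form of `TameInertiaProofs.exists_isGalois_ker_le`);
* the consequences for the recipe of Serre's weight (Duke Math. J. 54 (1987), §2.1 Prop. 1,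
  §2.2–2.4; file `SerreWeight`):
  `Literature.NumberTheory.GaloisRepresentations.ModPGaloisRep.exists_isSerreWeight_of_absUpperInertia_map` and
  `Literature.NumberTheory.GaloisRepresentations.ModPGaloisRep.isSerreWeight_serreWeightLocal_of_absUpperInertia_map` — the existence of a
  Serre weight `exists_isSerreWeight ρ ι` and the named fact `isSerreWeight_serreWeightLocal ρ ι`
  (the weight `serreWeightLocal ρ ι` satisfies Serre's recipe) for every `ρ̄ : Γ_F → GL₂(k)` and
  `ι`, granted the one remaining named fact, the surjectivity `I_F^v ↠ Gal(E/F)^v`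
  (`absUpperInertia_map_absRestrictNormalHom F`, file `SerreWeightExistence`; reduced to
  Herbrand's theorem `herbrand_quotient` in every characteristic by
  `SerreWeightExistenceProofs.absUpperInertia_map_absRestrictNormalHom_holds_of_herbrand_quotient`,
  and discharged with it in `SerreWeightRecipeProofs.lean`).

(An earlier revision of this file carried a second, finite-level proof of
`exists_eq_kummerCharacter_pow` — open kernel, the joint character `(χ, θ_d)` factoring through a
quotient of the cyclic group `G_0(E)/G_1(E)`, counting orders; it was withdrawn in favour of the
proof of `TameInertiaKummerProofs.lean`, which landed first, so that the tree carries one proof.)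

## References

* [SerreInventiones1972] J.-P. Serre, *Propriétés galoisiennes des points d'ordre fini des
  courbes elliptiques*, Invent. Math. 15 (1972), §1.3 (Prop. 2: `θ_d : Gal(K_d/K_nr) ≃ μ_d`,
  `I_t = lim← μ_d`), §1.7 (Prop. 5: characters of `I_t`).
* [SerreLocalFields1979] J.-P. Serre, *Local Fields*, GTM 67 (1979), Ch. IV §2, Prop. 7,
  Cor. 1 (`G_0/G_1` cyclic of order prime to `p`) and Cor. 3 (`G_1` is a `p`-group).
* [Serre1987] J.-P. Serre, *Sur les représentations modulaires de degré 2 de `Gal(ℚ̄/ℚ)`*, Duke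
  Math. J. 54 (1987), §2.1, Prop. 1; §2.2–2.4 (the recipe for `k`).
-/

noncomputable section

open scoped Pointwise Valued
open Field ValuativeRel

namespace Literature.NumberTheory.GaloisRepresentations

open GaloisRepresentations.IsNonarchimedeanLocalField

universe u v

variable {F : Type u} [Field F]

/-! ### A neighbourhood of `1` in `Γ_F` contains `Gal(F̄/E)` for a finite Galois `E` -/

section OpenKernel

/-- **Open subgroups and finite Galois levels.**  Every neighbourhood `U` of `1` in `Γ_F` (Krull
topology) contains the kernel of the restriction `Γ_F → Gal(E/F)` for some finite *Galois*
subextension `E/F` of `F̄`: by Mathlib's `krullTopology_mem_nhds_one_iff_of_normal`, `U`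
contains `Gal(F̄/E')` for a finite normal `E'`, and `Gal(F̄/E' ∩ F^{sep}) = Gal(F̄/E')`
(`TameInertiaProofs.mem_fixingSubgroup_of_mem_fixingSubgroup_inf_separableClosure`), with
`E = E' ∩ F^{sep}` finite Galois.  (The variant of `TameInertiaProofs.exists_isGalois_ker_le`
for a neighbourhood instead of the kernel of a continuous homomorphism.)
Ref: Neukirch, *Algebraic Number Theory*, Ch. IV §1, (1.2). [folklore] -/
theorem exists_isGalois_ker_subset {U : Set (absoluteGaloisGroup F)}
    (hU : U ∈ nhds (1 : absoluteGaloisGroup F)) :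
    ∃ E : IntermediateField F (AlgebraicClosure F), ∃ (_ : FiniteDimensional F E) (_ : IsGalois F E),
      ((absRestrictNormalHom (K := F) E).ker : Set (absoluteGaloisGroup F)) ⊆ U := by
  obtain ⟨E', hfin, hnorm, hE'⟩ :=
    (krullTopology_mem_nhds_one_iff_of_normal F (AlgebraicClosure F) _).mp hU
  haveI := hfin
  haveI := hnorm
  haveI hfinE : FiniteDimensional F (E' ⊓ separableClosure F (AlgebraicClosure F) :
      IntermediateField F (AlgebraicClosure F)) :=
    FiniteDimensional.of_injective
      (IntermediateField.inclusion (inf_le_left : E' ⊓ separableClosure F (AlgebraicClosure F) ≤ E')).toLinearMap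
      (IntermediateField.inclusion_injective
        (inf_le_left : E' ⊓ separableClosure F (AlgebraicClosure F) ≤ E'))
  haveI hsepE : Algebra.IsSeparable F (E' ⊓ separableClosure F (AlgebraicClosure F) :
      IntermediateField F (AlgebraicClosure F)) :=
    (le_separableClosure_iff F (AlgebraicClosure F) _).mp inf_le_right
  haveI hnormE : Normal F (E' ⊓ separableClosure F (AlgebraicClosure F) :
      IntermediateField F (AlgebraicClosure F)) := inferInstance
  haveI hgalE : IsGalois F (E' ⊓ separableClosure F (AlgebraicClosure F) :
      IntermediateField F (AlgebraicClosure F)) := ⟨⟩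
  refine ⟨E' ⊓ separableClosure F (AlgebraicClosure F), hfinE, hgalE, fun σ hσ => ?_⟩
  have hσ' : absoluteGaloisGroup.toAlgEquiv F σ ∈
      (E' ⊓ separableClosure F (AlgebraicClosure F)).fixingSubgroup := by
    rw [← IntermediateField.restrictNormalHom_ker]
    exact hσ
  exact hE' (mem_fixingSubgroup_of_mem_fixingSubgroup_inf_separableClosure F E' _ hσ')

end OpenKernel

variable [ValuativeRel F] [TopologicalSpace F] [IsNonarchimedeanLocalField F]
variable {k : Type v} [Field k]

/-! ### Values of the Kummer character -/

section KummerValues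

omit [TopologicalSpace F] [IsNonarchimedeanLocalField F] in
/-- The Kummer cocycle of an automorphism fixing the chosen root is `1`.
Ref: Serre, Invent. Math. 15 (1972), §1.3. [folklore] -/
theorem kummerCocycleInt_eq_one_of_smul_eq {n : ℕ} (hn : 0 < n) {a : 𝒪[F]} (ha : a ≠ 0)
    (σ : absoluteGaloisGroup F)
    (h : σ • (kummerRoot F hn a : AlgebraicClosure F) = kummerRoot F hn a) :
    kummerCocycleInt F hn ha σ = 1 :=
  Subtype.ext (by
    rw [coe_kummerCocycleInt, kummerCocycle, h, div_self (coe_kummerRoot_ne_zero hn ha),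
      OneMemClass.coe_one])

omit [TopologicalSpace F] [IsNonarchimedeanLocalField F] in
/-- The Kummer cocycle of an automorphism multiplying the chosen root `z` by `ζ ∈ S` is `ζ`.
Ref: Serre, Invent. Math. 15 (1972), §1.3 (`s(x^{1/d}) = θ_d(s) x^{1/d}`). [folklore] -/
theorem kummerCocycleInt_eq_of_smul_eq {n : ℕ} (hn : 0 < n) {a : 𝒪[F]} (ha : a ≠ 0)
    (σ : absoluteGaloisGroup F) {ζ : absIntegers 𝒪[F] F}
    (h : σ • (kummerRoot F hn a : AlgebraicClosure F) = ζ * kummerRoot F hn a) :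
    kummerCocycleInt F hn ha σ = ζ :=
  Subtype.ext (by
    rw [coe_kummerCocycleInt, kummerCocycle, h, mul_div_assoc,
      div_self (coe_kummerRoot_ne_zero hn ha), mul_one])

/-- The Kummer character is trivial on the elements of `I_F` fixing the chosen root.
Ref: Serre, Invent. Math. 15 (1972), §1.3. [folklore] -/
theorem kummerCharacter_eq_one_of_smul_eq {n : ℕ} (hn : 0 < n) {a : 𝒪[F]} (ha : a ≠ 0)
    (ι : absIntegers 𝒪[F] F ⧸ absMaximalIdeal F →+* k) (σ : absInertia F)
    (h : (σ : absoluteGaloisGroup F) • (kummerRoot F hn a : AlgebraicClosure F) = kummerRoot F hn a) :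
    kummerCharacter F hn ha ι σ = 1 := by
  ext
  rw [coe_kummerCharacter_apply, kummerCocycleInt_eq_one_of_smul_eq hn ha _ h, map_one, map_one,
    Units.val_one]

/-- If `σ ∈ I_F` multiplies the chosen root by `ζ ∈ S`, then `θ(σ) = ι(ζ mod 𝔓)`.
Ref: Serre, Invent. Math. 15 (1972), §1.3. [folklore] -/
theorem coe_kummerCharacter_eq_of_smul_eq {n : ℕ} (hn : 0 < n) {a : 𝒪[F]} (ha : a ≠ 0)
    (ι : absIntegers 𝒪[F] F ⧸ absMaximalIdeal F →+* k) (σ : absInertia F)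
    {ζ : absIntegers 𝒪[F] F}
    (h : (σ : absoluteGaloisGroup F) • (kummerRoot F hn a : AlgebraicClosure F) = ζ * kummerRoot F hn a) :
    (kummerCharacter F hn ha ι σ : k) = ι (Ideal.Quotient.mk _ ζ) := by
  rw [coe_kummerCharacter_apply, kummerCocycleInt_eq_of_smul_eq hn ha _ h]

/-- The Kummer character attached to `n`-th roots has exponent `n`: `θ(σ) ^ n = 1`.
Ref: Serre, Invent. Math. 15 (1972), §1.3 (`θ_d` takes values in `μ_d`). [folklore] -/
theorem kummerCharacter_pow_eq_one {n : ℕ} (hn : 0 < n) {a : 𝒪[F]} (ha : a ≠ 0)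
    (ι : absIntegers 𝒪[F] F ⧸ absMaximalIdeal F →+* k) (σ : absInertia F) :
    kummerCharacter F hn ha ι σ ^ n = 1 := by
  ext
  rw [Units.val_pow_eq_pow_val, coe_kummerCharacter_apply, ← map_pow, ← map_pow,
    kummerCocycleInt_pow, map_one, map_one, Units.val_one]

/-- `d` prime to the residue characteristic is non-zero in `F`. [folklore] -/
theorem neZero_natCast_of_not_ringChar_dvd {d : ℕ} (hpd : ¬ ringChar 𝓀[F] ∣ d) :
    NeZero ((d : ℕ) : F) := by
  refine ⟨fun h0 => hpd ?_⟩
  have hF : ringChar F ∣ d := (ringChar.spec F d).mp h0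
  have hpF : ringChar 𝓀[F] ∣ ringChar F := by
    rw [← ringChar.spec 𝓀[F]]
    have h' : ((ringChar F : ℕ) : 𝒪[F]) = 0 := Subtype.ext (by simp)
    rw [← map_natCast (IsLocalRing.residue 𝒪[F]), h', map_zero]
  exact hpF.trans hF

/-- **`θ_d` reaches a primitive `d`-th root of unity** (`p ∤ d`): there is `σ₀ ∈ I_F` such that
`θ_d(σ₀)` is a primitive `d`-th root of unity of `k`.  Indeed some `σ₀ ∈ I_F` multiplies
`z = ϖ^{1/d}` by a primitive `d`-th root of unity `ζ₀ ∈ F̄` (surjectivity of `θ_d`,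
`exists_mem_absInertia_smul_eq_mul`), and `ι(ζ₀ mod 𝔓)` keeps order `d` because roots of unity
of order prime to `p` are distinct modulo the proper ideal `ker (ι ∘ mk) ⊇ 𝔓`.
Ref: Serre, Invent. Math. 15 (1972), §1.3, Prop. 2 ("`θ_d` … est un isomorphisme"; "`μ_d`
s'identifie par réduction … aux racines `d`-ièmes de l'unité de `k_s`").
[cite: SerreInventiones1972, §1.3 Prop. 2] -/
theorem exists_isPrimitiveRoot_kummerCharacter (ι : absIntegers 𝒪[F] F ⧸ absMaximalIdeal F →+* k)
    {d : ℕ} (hd : 0 < d) (hpd : ¬ ringChar 𝓀[F] ∣ d) {ϖ : 𝒪[F]} (hϖ : Irreducible ϖ) :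
    ∃ σ₀ : absInertia F, IsPrimitiveRoot (kummerCharacter F hd hϖ.ne_zero ι σ₀) d := by
  classical
  haveI := neZero_natCast_of_not_ringChar_dvd (F := F) hpd
  haveI : NeZero ((d : ℕ) : AlgebraicClosure F) :=
    NeZero.nat_of_injective (algebraMap F (AlgebraicClosure F)).injective
  obtain ⟨ζ₀, hζ₀⟩ := HasEnoughRootsOfUnity.exists_primitiveRoot (AlgebraicClosure F) d
  have hζint : IsIntegral 𝒪[F] ζ₀ :=
    IsIntegral.of_pow hd (by rw [hζ₀.pow_eq_one]; exact isIntegral_one)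
  set ζS : absIntegers 𝒪[F] F := ⟨ζ₀, hζint⟩ with hζS
  have hζS' : IsPrimitiveRoot ζS d :=
    IsPrimitiveRoot.of_map_of_injective (f := (absIntegers 𝒪[F] F).val) (by exact hζ₀)
      Subtype.val_injective
  obtain ⟨σ₀, hσ₀I, hσ₀⟩ := exists_mem_absInertia_smul_eq_mul hd hϖ (coe_kummerRoot_pow F hd ϖ)
    hζ₀.pow_eq_one
  refine ⟨⟨σ₀, hσ₀I⟩, ?_⟩
  rw [← IsPrimitiveRoot.coe_units_iff,
    coe_kummerCharacter_eq_of_smul_eq hd hϖ.ne_zero ι ⟨σ₀, hσ₀I⟩ (ζ := ζS) hσ₀]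
  let φ : absIntegers 𝒪[F] F →+* k := ι.comp (Ideal.Quotient.mk (absMaximalIdeal F))
  change IsPrimitiveRoot (φ ζS) d
  refine IsPrimitiveRoot.mk_of_lt _ hd ?_ fun l hl0 hle => ?_
  · rw [← map_pow, hζS'.pow_eq_one, map_one]
  · intro hl
    have hQ : RingHom.ker φ ≠ ⊤ := RingHom.ker_ne_top φ
    have hmem : ζS ^ l - 1 ∈ RingHom.ker φ := by
      rw [RingHom.mem_ker, map_sub, map_pow, hl, map_one, sub_self]
    have hpow : (ζS ^ l) ^ d = 1 := by
      rw [← pow_mul, mul_comm, pow_mul, hζS'.pow_eq_one, one_pow]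
    have := eq_one_of_pow_eq_one_of_sub_one_mem hQ hd hpd hpow hmem
    exact hζS'.pow_ne_one_of_pos_of_lt hl0.ne' hle this

end KummerValues

/-! ### Consequences for the recipe of Serre's weight -/

namespace ModPGaloisRep

variable {k : Type v} [Field k] [TopologicalSpace k]

/-- **Existence of a Serre weight on the last leaf.**  For every continuous
`ρ̄ : Γ_F → GL₂(k)` (`k` discrete) and residue embedding `ι`, some case of Serre's recipe applies
(`exists_isSerreWeight ρ ι`), granted the surjectivity `I_F^v ↠ Gal(E/F)^v`
(`absUpperInertia_map_absRestrictNormalHom F`): `SerreWeightExistence.exists_isSerreWeight_of` fed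
with `exists_eq_kummerCharacter_pow_holds` (`TameInertiaKummerProofs.lean`).
Ref: Serre, Duke Math. J. 54 (1987), §2.1 Prop. 1, §2.2–2.4.
[cite: Serre1987, §2.1 Prop. 1; §2.2–2.4] -/
theorem exists_isSerreWeight_of_absUpperInertia_map (hD : absUpperInertia_map_absRestrictNormalHom F)
    (ρ : ModPGaloisRep F k 2) (ι : absIntegers 𝒪[F] F ⧸ absMaximalIdeal F →+* k) :
    ρ.exists_isSerreWeight ι :=
  ρ.exists_isSerreWeight_of hD ι (exists_eq_kummerCharacter_pow_holds F k)

/-- **`serreWeightLocal` satisfies Serre's recipe, on the last leaf**: the named fact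
`isSerreWeight_serreWeightLocal ρ ι` of `SerreWeight.lean` for every `ρ̄`, `ι`, granted
`absUpperInertia_map_absRestrictNormalHom F` (by `isSerreWeight_serreWeightLocal_of` and
`exists_isSerreWeight_of_absUpperInertia_map`).
Ref: Serre, Duke Math. J. 54 (1987), §2.1 Prop. 1, §2.2–2.4 (pp. 125–128 of Œuvres IV).
[cite: Serre1987, §2.1 Prop. 1; §2.2–2.4] -/
theorem isSerreWeight_serreWeightLocal_of_absUpperInertia_map
    (hD : absUpperInertia_map_absRestrictNormalHom F)
    (ρ : ModPGaloisRep F k 2) (ι : absIntegers 𝒪[F] F ⧸ absMaximalIdeal F →+* k) :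
    ρ.isSerreWeight_serreWeightLocal ι :=
  ρ.isSerreWeight_serreWeightLocal_of ι (exists_isSerreWeight_of_absUpperInertia_map hD ρ ι)

end ModPGaloisRep

end Literature.NumberTheory.GaloisRepresentations
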